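import Literature.NumberTheory.LFunctions.ZetaZeros
import HarnessLib

/-!
# Littlewood's theorem: the gaps between consecutive ordinates of the zeros of `ζ` tend to zero

Trunk T-ANT (`Literature/NumberTheory/LFunctions`).  ONE named fact (D-0014), hypothesis-only, recording Theorem 9.12 of
Titchmarsh, *The Theory of the Riemann Zeta-Function* (2nd ed., revised by Heath-Brown, 1986), due to Littlewood (1924):
for every large `T` there is a zero `β + iγ` of `ζ` with `|γ − T| < A / log log log T`; in particular
`γ_{n+1} − γ_n → 0`.  We record the qualitative consequence «every large `T` is within `ε` of a zero ordinate», which is the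
form consumed by the rh-split cell's synthesis-screening reduction (`Theorems/Splittings/BombieriTruncSynthesisScreening.lean`,
input D5′ of card `SPLIT-x-wuc.md` §13).  Compare `Literature/NumberTheory/LFunctions/ZeroGaps.lean` (Selberg–Fujii: positive
proportions of large / small NORMALISED gaps — a different statement, neither implies the other as typed).

* `Literature.NumberTheory.LFunctions.littlewood_zero_ordinate_gaps_shrink` — `∀ ε > 0, ∃ T₁, ∀ T ≥ T₁, ∃ ρ ∈ 𝒵(ζ) non-trivial, |Im ρ − T| ≤ ε`.

Design: stated over `Literature.NumberTheory.LFunctions.ZetaZeros.riemannZetaNontrivialZeros` (the trunk's set of non-trivial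
zeros) with a plain `|Im ρ − T| ≤ ε`, no ordinate indexing, so that users need no counting-function API.  Sorry-free;
no instances, no notation.  Provenance: cell rh-split, seat rh-split-x-wuc g7 (cut (xiv-d) L0).
-/

noncomputable section

namespace Literature.NumberTheory.LFunctions

/-- **Littlewood's theorem on the gaps between ordinates of the zeros of `ζ` (qualitative form).**
Titchmarsh, *The Theory of the Riemann Zeta-Function*, 2nd ed., Theorem 9.12: «For every large positive `T`, `ζ(s)` has a
zero `β + iγ` satisfying `|γ − T| < A / log log log T`» (Littlewood 1924).  Recorded here in the weaker qualitative form that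
is all its users need: for every `ε > 0`, every sufficiently large `T` is within `ε` of the ordinate of a non-trivial zero
(equivalently: the gaps between consecutive ordinates tend to `0`).  Named fact (D-0014), proved in print, not in the tree;
used only as a hypothesis `(h : littlewood_zero_ordinate_gaps_shrink)` — e.g. by
`Summit.RiemannHypothesis.RiemannHypothesis.Theorems.Splittings.BombieriTruncSynthesisScreening.synthesisScreening_of`.
[cite: Titchmarsh1986, Thm 9.12] -/
def littlewood_zero_ordinate_gaps_shrink : Prop :=
  ∀ ε : ℝ, 0 < ε → ∃ T₁ : ℝ, ∀ T : ℝ, T₁ ≤ T →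
    ∃ ρ ∈ ZetaZeros.riemannZetaNontrivialZeros, |ρ.im - T| ≤ ε

end Literature.NumberTheory.LFunctions
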